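import Literature.Barriers.AtomisticToContinuum.AnticontinuumLocalizationSolution
import HarnessLib

/-!
# De Roeck–Huveneers 2015, §5.3 for the rotor chain: locality of `U_a` and `G_a`

`Literature/Barriers/AtomisticToContinuum/` — continuation of `AnticontinuumLocalizationSolution.lean`.
The two-sided locality argument of §5.3 of W. De Roeck, F. Huveneers, CPAM 68 (2015),
arXiv:1305.5127 ("the function `x ↦ J_{a,a+1} - L_H U_a` … vanishes for `c < a`; … then we use
`H_{>a} - H^O_{>a} = (H - H_{≤a}) - (H - H^O_{≤a})` … for `c > a`"), PROVED for the explicit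
`U₀`, `G₀`:

* `DepSites S f`: a phase-space function depends only on the coordinates at the sites of `S`;
  closure under algebra, coordinate derivatives and Poisson brackets (`DepSites.poisson`, with
  `poisson_eq_zero_of_disjoint`), brackets with sums of local terms thicken the site set by `2R`
  (`DepSites.poisson_ev_local`), hence `ad`, `e^{ε^p ad u}`, `R`, `𝒯` thicken by `2Rn`, `2Rn²`;
* left-locality of `U₀ = H^O_{>a} - 𝒯R H̃_{>a}` and right-locality of
  `U₀ = -(H^O_{≤a}) + 𝒯R H̃_{≤a}` (`U0_eq_neg_head_add`), glued into
  **`dependsOnlyNear_U0`**: `U₀` depends only on the sites within `locRad` of the bond; and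
  **`dependsOnlyNear_G0`** for `G₀ = ε^{-(n₀+1)}(εJ - L_H U₀)`.
-/

noncomputable section

open Function Set Finset Filter Metric
open scoped ContDiff BigOperators Topology

namespace Literature.Barriers.AtomisticToContinuum.HeatConduction.RotorChain

open Literature.MathematicalPhysics.KineticTheory.HeatConduction
open Literature.Analysis.Calculus Literature.Analysis.Calculus.IsDeltaSymbol
open Literature.Algebra.Lie Literature.Algebra.Lie.TruncSeries

variable {m : ℕ}

/-! ### Dependence on a set of sites -/

/-- `f` depends only on the coordinates `(q_y, ω_y)`, `y ∈ S`. [cite: DeRoeckHuveneers2015, §2.3 Thm 1 ("depend only on variables labeled by `z ∈ ℤ_N` with `|z - a| ≤ C_n`")] -/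
def DepSites (S : Set (Fin m)) (f : PhaseSpace m → ℝ) : Prop :=
  ∀ z z' : PhaseSpace m, (∀ y ∈ S, z.1 y = z'.1 y ∧ z.2 y = z'.2 y) → f z = f z'

namespace DepSites

variable {S S' : Set (Fin m)} {f g : PhaseSpace m → ℝ}

/-- Monotonicity. [folklore] -/
theorem mono (h : DepSites S f) (hSS' : S ⊆ S') : DepSites S' f := fun z z' hz => h z z' fun y hy => hz y (hSS' hy)

/-- Constants. [folklore] -/
theorem const (S : Set (Fin m)) (c : ℝ) : DepSites S (fun _ : PhaseSpace m => c) := fun _ _ _ => rfl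

/-- Sums. [folklore] -/
theorem add (hf : DepSites S f) (hg : DepSites S g) : DepSites S (fun z => f z + g z) :=
  fun z z' hz => by dsimp only; rw [hf z z' hz, hg z z' hz]

/-- Sums (pointwise form). [folklore] -/
theorem add' (hf : DepSites S f) (hg : DepSites S g) : DepSites S (f + g) := hf.add hg

/-- Differences. [folklore] -/
theorem sub (hf : DepSites S f) (hg : DepSites S g) : DepSites S (fun z => f z - g z) :=
  fun z z' hz => by dsimp only; rw [hf z z' hz, hg z z' hz]

/-- Products. [folklore] -/
theorem mul (hf : DepSites S f) (hg : DepSites S g) : DepSites S (fun z => f z * g z) :=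
  fun z z' hz => by dsimp only; rw [hf z z' hz, hg z z' hz]

/-- Negation. [folklore] -/
theorem neg (hf : DepSites S f) : DepSites S (fun z => -f z) := fun z z' hz => by dsimp only; rw [hf z z' hz]

/-- Scalar multiples. [folklore] -/
theorem const_mul (hf : DepSites S f) (c : ℝ) : DepSites S (fun z => c * f z) := fun z z' hz => by dsimp only; rw [hf z z' hz]

/-- Finite sums. [folklore] -/
theorem sum {ι : Type*} (s : Finset ι) {f : ι → PhaseSpace m → ℝ} (h : ∀ i ∈ s, DepSites S (f i)) :
    DepSites S (fun z => ∑ i ∈ s, f i z) := fun z z' hz => by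
  dsimp only; exact Finset.sum_congr rfl fun i hi => h i hi z z' hz

/-- List sums. [folklore] -/
theorem listSum {α : Type*} (l : List α) {f : α → PhaseSpace m → ℝ} (h : ∀ a ∈ l, DepSites S (f a)) :
    DepSites S (fun z => (l.map fun a => f a z).sum) := by
  intro z z' hz
  dsimp only
  exact congrArg List.sum (List.map_congr_left fun a ha => h a ha z z' hz)

/-! #### Coordinate derivatives and brackets -/

/-- `∂_{q_y} f` depends on the same sites. [folklore] -/
theorem partialQ (hf : DepSites S f) (y : Fin m) : DepSites S (partialQ y f) := by
  intro z z' hz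
  unfold Literature.MathematicalPhysics.KineticTheory.HeatConduction.partialQ
  by_cases hy : y ∈ S
  · have e : (fun t => f (Function.update z.1 y t, z.2)) = fun t => f (Function.update z'.1 y t, z'.2) := by
      funext t
      refine hf _ _ fun x hx => ?_
      by_cases hxy : x = y
      · subst hxy; simp [(hz x hx).2]
      · simp [Function.update_of_ne hxy, (hz x hx).1, (hz x hx).2]
    rw [e, (hz y hy).1]
  · have e : ∀ w : PhaseSpace m, (fun t => f (Function.update w.1 y t, w.2)) = fun _ => f w := by
      intro w; funext t
      refine hf _ _ fun x hx => ?_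
      have hxy : x ≠ y := fun h => hy (h ▸ hx)
      simp [Function.update_of_ne hxy]
    rw [e z, e z', deriv_const, deriv_const]

/-- `∂_{ω_y} f` depends on the same sites. [folklore] -/
theorem partialP (hf : DepSites S f) (y : Fin m) : DepSites S (partialP y f) := by
  intro z z' hz
  unfold Literature.MathematicalPhysics.KineticTheory.HeatConduction.partialP
  by_cases hy : y ∈ S
  · have e : (fun t => f (z.1, Function.update z.2 y t)) = fun t => f (z'.1, Function.update z'.2 y t) := by
      funext t
      refine hf _ _ fun x hx => ?_
      by_cases hxy : x = y
      · subst hxy; simp [(hz x hx).1]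
      · simp [Function.update_of_ne hxy, (hz x hx).1, (hz x hx).2]
    rw [e, (hz y hy).2]
  · have e : ∀ w : PhaseSpace m, (fun t => f (w.1, Function.update w.2 y t)) = fun _ => f w := by
      intro w; funext t
      refine hf _ _ fun x hx => ?_
      have hxy : x ≠ y := fun h => hy (h ▸ hx)
      simp [Function.update_of_ne hxy]
    rw [e z, e z', deriv_const, deriv_const]

/-- `∂_{q_y} f = 0` for `y ∉ S`. [folklore] -/
theorem partialQ_eq_zero (hf : DepSites S f) {y : Fin m} (hy : y ∉ S) (z : PhaseSpace m) : _root_.Literature.MathematicalPhysics.KineticTheory.HeatConduction.partialQ y f z = 0 := by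
  unfold Literature.MathematicalPhysics.KineticTheory.HeatConduction.partialQ
  have e : (fun t => f (Function.update z.1 y t, z.2)) = fun _ => f z := by
    funext t
    refine hf _ _ fun x hx => ?_
    have hxy : x ≠ y := fun h => hy (h ▸ hx)
    simp [Function.update_of_ne hxy]
  rw [e, deriv_const]

/-- `∂_{ω_y} f = 0` for `y ∉ S`. [folklore] -/
theorem partialP_eq_zero (hf : DepSites S f) {y : Fin m} (hy : y ∉ S) (z : PhaseSpace m) : _root_.Literature.MathematicalPhysics.KineticTheory.HeatConduction.partialP y f z = 0 := by
  unfold Literature.MathematicalPhysics.KineticTheory.HeatConduction.partialP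
  have e : (fun t => f (z.1, Function.update z.2 y t)) = fun _ => f z := by
    funext t
    refine hf _ _ fun x hx => ?_
    have hxy : x ≠ y := fun h => hy (h ▸ hx)
    simp [Function.update_of_ne hxy]
  rw [e, deriv_const]

/-- **Brackets see only the union of the site sets.** [folklore] -/
theorem poisson (hf : DepSites S f) (hg : DepSites S' g) : DepSites (S ∪ S') (_root_.Literature.MathematicalPhysics.KineticTheory.HeatConduction.poisson f g) := by
  have hf' := hf.mono (Set.subset_union_left (t := S'))
  have hg' := hg.mono (Set.subset_union_right (s := S))
  unfold Literature.MathematicalPhysics.KineticTheory.HeatConduction.poisson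
  exact DepSites.sum _ fun y _ => ((hf'.partialP y).mul (hg'.partialQ y)).sub ((hf'.partialQ y).mul (hg'.partialP y))

/-- **Functions of disjoint sets of sites have zero bracket.** [folklore] -/
theorem poisson_eq_zero_of_disjoint (hf : DepSites S f) (hg : DepSites S' g) (hSS' : Disjoint S S') (z : PhaseSpace m) :
    _root_.Literature.MathematicalPhysics.KineticTheory.HeatConduction.poisson f g z = 0 := by
  unfold Literature.MathematicalPhysics.KineticTheory.HeatConduction.poisson
  refine Finset.sum_eq_zero fun y _ => ?_
  by_cases hy : y ∈ S
  · have hy' : y ∉ S' := Set.disjoint_left.1 hSS' hy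
    rw [hg.partialQ_eq_zero hy', hg.partialP_eq_zero hy']; ring
  · rw [hf.partialQ_eq_zero hy, hf.partialP_eq_zero hy]; ring

end DepSites

/-! ### Locality of symbolic terms -/

/-- A term supported within `R` of its anchor depends only on that ball. [cite: DeRoeckHuveneers2015, §3.1 ("`f_x` depends only on variables indexed by `z` with `z ∈ B(x,r)`")] -/
theorem depSites_ev_term {t : TrigTerm m} {R : ℕ} (ht : t.SuppWithin R) (δ : ℝ) : DepSites (siteBall t.pos R) (t.ev δ) := by
  intro z z' hz
  have hq : modePhase t.mode z.1 = modePhase t.mode z'.1 := by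
    unfold modePhase
    refine Finset.sum_congr rfl fun y _ => ?_
    by_cases hy : Nat.dist t.pos.val y.val ≤ R
    · rw [(hz y (mem_siteBall.2 hy)).1]
    · rw [ht.1 y (not_le.1 hy)]; simp
  have ha : t.cosCoeff δ z.2 = t.cosCoeff δ z'.2 := (ht.2 δ).1 fun y hy => (hz y hy).2
  have hb : t.sinCoeff δ z.2 = t.sinCoeff δ z'.2 := (ht.2 δ).2 fun y hy => (hz y hy).2
  simp only [TrigTerm.ev, hq, ha, hb]

/-- A functional multiple of a term: sites of the term and of the multiplier. [folklore] -/
theorem depSites_ev_smulFun {t : TrigTerm m} {R : ℕ} (ht : t.SuppWithin R) {θ : ℝ → (Fin m → ℝ) → ℝ} {Sθ : Set (Fin m)}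
    (hθ : ∀ δ, DependsOn (θ δ) Sθ) (δ : ℝ) : DepSites (siteBall t.pos R ∪ Sθ) ((t.smulFun θ).ev δ) := by
  have e : (t.smulFun θ).ev δ = fun z => θ δ z.2 * t.ev δ z := funext fun z => TrigTerm.ev_smulFun θ t δ z
  rw [e]
  refine DepSites.mul (fun z z' hz => hθ δ fun y hy => (hz y (Set.mem_union_right _ hy)).2)
    ((depSites_ev_term ht δ).mono (Set.subset_union_left))

/-- Evaluations of polynomials all of whose terms depend on `S`. [folklore] -/
theorem depSites_ev {F : TrigPoly m} {S : Set (Fin m)} {δ : ℝ} (h : ∀ t ∈ F, DepSites S (t.ev δ)) : DepSites S (TrigPoly.ev F δ) := by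
  have e : TrigPoly.ev F δ = fun z => (F.map fun t => t.ev δ z).sum := rfl
  rw [e]; exact DepSites.listSum F h

/-! ### Thickening and brackets with sums of local terms -/

/-- The `R`-thickening of a set of sites. [folklore] -/
def thick (R : ℕ) (S : Set (Fin m)) : Set (Fin m) := {y | ∃ y' ∈ S, Nat.dist y.val y'.val ≤ R}

/-- `S ⊆ thick R S`. [folklore] -/
theorem subset_thick (R : ℕ) (S : Set (Fin m)) : S ⊆ thick R S := fun y hy => ⟨y, hy, by simp [Nat.dist_self]⟩

/-- Monotonicity in `R`. [folklore] -/
theorem thick_mono {R R' : ℕ} (h : R ≤ R') (S : Set (Fin m)) : thick R S ⊆ thick R' S :=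
  fun _ ⟨y', hy', hd⟩ => ⟨y', hy', hd.trans h⟩

/-- Monotonicity in `S`. [folklore] -/
theorem thick_mono_set (R : ℕ) {S S' : Set (Fin m)} (h : S ⊆ S') : thick R S ⊆ thick R S' :=
  fun _ ⟨y', hy', hd⟩ => ⟨y', h hy', hd⟩

/-- Iterated thickening. [folklore] -/
theorem thick_thick (R R' : ℕ) (S : Set (Fin m)) : thick R (thick R' S) ⊆ thick (R + R') S := by
  rintro y ⟨y', ⟨y'', hy'', hd'⟩, hd⟩
  refine ⟨y'', hy'', ?_⟩
  have := Nat.dist.triangle_inequality y.val y'.val y''.val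
  omega

/-- Thickening a right half-line. [folklore] -/
theorem thick_ge_subset (R c : ℕ) : thick R {y : Fin m | c ≤ y.val} ⊆ {y : Fin m | c ≤ y.val + R} := by
  rintro y ⟨y', hy', hd⟩
  simp only [Set.mem_setOf_eq] at hy' ⊢
  unfold Nat.dist at hd; omega

/-- Thickening a left half-line. [folklore] -/
theorem thick_le_subset (R c : ℕ) : thick R {y : Fin m | y.val ≤ c} ⊆ {y : Fin m | y.val ≤ c + R} := by
  rintro y ⟨y', hy', hd⟩
  simp only [Set.mem_setOf_eq] at hy' ⊢
  unfold Nat.dist at hd; omega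

/-- **Bracket with a sum of `R`-local terms thickens the site set by `2R`**: for `U` good with radius
`R` and `g` depending on `S`, `{ev U, g}` depends on `thick (2R) S` (far terms bracket to zero).
[cite: DeRoeckHuveneers2015, §3.3 ("`(R^{(k)} f)_x` depends on `x_c` with `|x - c| ≤ r_k + r(f)`")] -/
theorem DepSites.poisson_ev_local {U : TrigPoly m} {R : ℕ} {δ : ℝ} (hU : U.Good R δ) {S : Set (Fin m)} {g : PhaseSpace m → ℝ}
    (hg : DepSites S g) : DepSites (thick (2 * R) S) (_root_.Literature.MathematicalPhysics.KineticTheory.HeatConduction.poisson (TrigPoly.ev U δ) g) := by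
  have e : _root_.Literature.MathematicalPhysics.KineticTheory.HeatConduction.poisson (TrigPoly.ev U δ) g =
      fun z => (U.map fun s => _root_.Literature.MathematicalPhysics.KineticTheory.HeatConduction.poisson (s.ev δ) g z).sum := by
    funext z
    -- list bilinearity (as in `poisson_ev_left`, inlined)
    induction U with
    | nil =>
      have e0 : TrigPoly.ev ([] : TrigPoly m) δ = fun _ => (0 : ℝ) := funext fun z => TrigPoly.ev_nil δ z
      rw [e0]; simp [poisson_const_left]
    | cons t F ih =>
      have ht := hU.2 t (by simp)
      have hF : TrigPoly.Good F R δ := ⟨fun s hs => hU.1 s (by simp [hs]), fun s hs => hU.2 s (by simp [hs])⟩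
      have e1 : TrigPoly.ev (t :: F) δ = (t.ev δ) + TrigPoly.ev F δ := funext fun z => TrigPoly.ev_cons t F δ z
      rw [e1, poisson_add_left (t.differentiable_ev ht.differentiable.1 ht.differentiable.2)
        (TrigPoly.differentiable_ev F fun s hs => (hF.2 s hs).differentiable), ih hF]
      simp
  rw [e]
  refine DepSites.listSum U fun s hs => ?_
  by_cases hdis : Disjoint (siteBall s.pos R) S
  · have h0 : ∀ z, _root_.Literature.MathematicalPhysics.KineticTheory.HeatConduction.poisson (s.ev δ) g z = 0 :=
      fun z => (depSites_ev_term (hU.1 s hs) δ).poisson_eq_zero_of_disjoint hg hdis z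
    intro z z' _; rw [h0 z, h0 z']
  · have hsub : siteBall s.pos R ∪ S ⊆ thick (2 * R) S := by
      obtain ⟨y₀, hy₀b, hy₀S⟩ := Set.not_disjoint_iff.1 hdis
      refine Set.union_subset (fun y hy => ⟨y₀, hy₀S, ?_⟩) ((subset_thick 0 S).trans (thick_mono (Nat.zero_le _) _))
      have h1 := mem_siteBall.1 hy
      have h2 := mem_siteBall.1 hy₀b
      have := Nat.dist.triangle_inequality y.val s.pos.val y₀.val
      rw [Nat.dist_comm y.val s.pos.val] at this
      omega
    exact ((depSites_ev_term (hU.1 s hs) δ).poisson hg).mono hsub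

/-! ### Locality through the Lie-series operations -/

section TS

variable {n : ℕ}

/-- All coefficients depend on `S`. [folklore] -/
def DepSitesTS (S : Set (Fin m)) (F : TruncSeries (SmoothFun m) n) : Prop := ∀ j, DepSites S (F.coeff j).val

/-- Bracket with a generator represented by a good polynomial of radius `R`. [folklore] -/
theorem DepSites.lie_local {U : TrigPoly m} {R : ℕ} {δ : ℝ} (hU : U.Good R δ) {u : SmoothFun m} (hu : u.val = TrigPoly.ev U δ)
    {S : Set (Fin m)} {f : SmoothFun m} (hf : DepSites S f.val) : DepSites (thick (2 * R) S) (⁅u, f⁆ : SmoothFun m).val := by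
  rw [SmoothFun.val_lie, hu]; exact DepSites.poisson_ev_local hU hf

/-- Iterated brackets: `thick (2 R i) S`. [folklore] -/
theorem DepSites.adPow_local {U : TrigPoly m} {R : ℕ} {δ : ℝ} (hU : U.Good R δ) {u : SmoothFun m} (hu : u.val = TrigPoly.ev U δ)
    {S : Set (Fin m)} : ∀ (i : ℕ) {f : SmoothFun m}, DepSites S f.val →
      DepSites (thick (2 * R * i) S) ((fun x : SmoothFun m => ⁅u, x⁆)^[i] f).val := by
  intro i
  induction i with
  | zero => intro f hf; simpa using hf.mono (subset_thick _ _)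
  | succ i ih =>
    intro f hf
    rw [Function.iterate_succ_apply']
    refine (DepSites.lie_local hU hu (ih hf)).mono ((thick_thick _ _ _).trans (thick_mono (by ring_nf; omega) _))

/-- `e^{ε^p ad u}`: `thick (2 R n) S`. [folklore] -/
theorem DepSitesTS.expOp {U : TrigPoly m} {R : ℕ} {δ : ℝ} (hU : U.Good R δ) {u : SmoothFun m} (hu : u.val = TrigPoly.ev U δ)
    {p : ℕ} (hp : 1 ≤ p) {S : Set (Fin m)} {F : TruncSeries (SmoothFun m) n} (hF : DepSitesTS S F) :
    DepSitesTS (thick (2 * R * n) S) (TruncSeries.expOp p u F) := by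
  intro j
  by_cases hj : j ≤ n
  · rw [TruncSeries.expOp_coeff hp u F hj, SmoothFun.val_sum]
    refine DepSites.sum _ fun i hi => ?_
    have hin : i ≤ n := Nat.lt_succ_iff.1 (Finset.mem_range.1 hi)
    by_cases hij : i * p ≤ j
    · rw [if_pos hij, SmoothFun.val_smul]
      exact ((DepSites.adPow_local hU hu i (hF _)).mono (thick_mono (Nat.mul_le_mul_left _ hin) _)).const_mul _
    · rw [if_neg hij]; exact DepSites.const _ _
  · rw [TruncSeries.coeff_eq_zero _ (not_le.1 hj)]; exact DepSites.const _ _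

/-- `R_k`: `thick (2 R n k) S`. [cite: DeRoeckHuveneers2015, §3.3] -/
theorem DepSitesTS.rOp {Us : ℕ → TrigPoly m} {R : ℕ} {δ : ℝ} (hU : ∀ k, 1 ≤ k → (Us k).Good R δ) {u : ℕ → SmoothFun m}
    (hu : ∀ k, 1 ≤ k → (u k).val = TrigPoly.ev (Us k) δ) {S : Set (Fin m)} :
    ∀ (k : ℕ) {F : TruncSeries (SmoothFun m) n}, DepSitesTS S F → DepSitesTS (thick (2 * R * n * k) S) (TruncSeries.rOp u k F) := by
  intro k
  induction k generalizing S with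
  | zero => intro F hF j; simpa using (hF j).mono (subset_thick _ _)
  | succ k ih =>
    intro F hF
    rw [TruncSeries.rOp_succ]
    have hneg : (-u (k + 1)).val = TrigPoly.ev (TrigPoly.neg (Us (k + 1))) δ := by
      funext z; rw [SmoothFun.val_neg, Pi.neg_apply, hu _ (Nat.succ_pos k), TrigPoly.ev_neg]
    have h1 := DepSitesTS.expOp (hU _ (Nat.succ_pos k)).neg hneg (Nat.succ_pos k) hF
    refine fun j => (ih h1 j).mono ((thick_thick _ _ _).trans (thick_mono (by ring_nf; omega) _))

/-- `𝒯_n`: same sites. [folklore] -/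
theorem DepSitesTS.eval {S : Set (Fin m)} {F : TruncSeries (SmoothFun m) n} (hF : DepSitesTS S F) (ε : ℝ) :
    DepSites S (TruncSeries.eval ε F).val := by
  intro z z' hz
  rw [SmoothFun.val_eval, SmoothFun.val_eval]
  exact Finset.sum_congr rfl fun j _ => by rw [(hF j) z z' hz]

end TS

/-! ### The two half-line localities of `U₀` and the gluing -/

section Loc

variable {r L n₂ : ℕ} {Θ : ResonanceCutoffs m r L n₂} {b : Fin m} {n₃ : ℕ} {γ : ℝ} {n : ℕ} {δ : ℝ}

/-- Terms of `H̃^{(j)}_{>x}`, `x ∈ B(a,n₃)`, times a partition function depend on the right half-line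
from `a - n₃ - max(r_n, Rθ)`. [cite: DeRoeckHuveneers2015, §5.3] -/
theorem depSites_hgtPoly (δ : ℝ) {j : ℕ} (hj : j ≤ n) :
    DepSites {y : Fin m | b.val ≤ y.val + (n₃ + stageRad n n + Θ.Rθ)} (TrigPoly.ev (hgtPoly Θ b n₃ γ n j) δ) := by
  have hG := stage_good m γ n δ n j hj
  refine depSites_ev fun t ht => ?_
  unfold hgtPoly at ht
  rcases List.mem_append.1 ht with h | h
  · obtain ⟨x, hx, htx⟩ := List.mem_flatMap.1 h
    rw [Finset.mem_toList] at hx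
    obtain ⟨s, hs, rfl⟩ := List.mem_map.1 htx
    obtain ⟨hsF, hxs⟩ := mem_tailP.1 hs
    refine (depSites_ev_smulFun (hG.1 s hsF) (fun δ' => dependsOn_vt hx δ') δ).mono ?_
    rintro y (hy | hy)
    · have h1 := mem_siteBall.1 hy
      have h2 := mem_nearSites.1 hx
      have h3 : x.val < s.pos.val := hxs
      simp only [Set.mem_setOf_eq]; unfold Nat.dist at h1 h2; omega
    · have h1 := mem_siteBall.1 hy
      simp only [Set.mem_setOf_eq]; unfold Nat.dist at h1; omega
  · obtain ⟨s, hs, rfl⟩ := List.mem_map.1 h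
    obtain ⟨hsF, hbs⟩ := mem_tailP.1 hs
    refine (depSites_ev_smulFun (hG.1 s hsF) (fun δ' => dependsOn_vtStar δ') δ).mono ?_
    rintro y (hy | hy)
    · have h1 := mem_siteBall.1 hy
      have h3 : b.val < s.pos.val := hbs
      simp only [Set.mem_setOf_eq]; unfold Nat.dist at h1; omega
    · have h1 := mem_siteBall.1 hy
      simp only [Set.mem_setOf_eq]; unfold Nat.dist at h1; omega

/-- Terms of `H̃^{(j)}_{≤x}` times a partition function depend on the left half-line up to
`a + n₃ + max(r_n, Rθ)`. [cite: DeRoeckHuveneers2015, §5.3] -/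
theorem depSites_hlePoly (δ : ℝ) {j : ℕ} (hj : j ≤ n) :
    DepSites {y : Fin m | y.val ≤ b.val + (n₃ + stageRad n n + Θ.Rθ)} (TrigPoly.ev (hlePoly Θ b n₃ γ n j) δ) := by
  have hG := stage_good m γ n δ n j hj
  refine depSites_ev fun t ht => ?_
  unfold hlePoly at ht
  rcases List.mem_append.1 ht with h | h
  · obtain ⟨x, hx, htx⟩ := List.mem_flatMap.1 h
    rw [Finset.mem_toList] at hx
    obtain ⟨s, hs, rfl⟩ := List.mem_map.1 htx
    obtain ⟨hsF, hxs⟩ := mem_headP.1 hs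
    refine (depSites_ev_smulFun (hG.1 s hsF) (fun δ' => dependsOn_vt hx δ') δ).mono ?_
    rintro y (hy | hy)
    · have h1 := mem_siteBall.1 hy
      have h2 := mem_nearSites.1 hx
      have h3 : s.pos.val ≤ x.val := hxs
      simp only [Set.mem_setOf_eq]; unfold Nat.dist at h1 h2; omega
    · have h1 := mem_siteBall.1 hy
      simp only [Set.mem_setOf_eq]; unfold Nat.dist at h1; omega
  · obtain ⟨s, hs, rfl⟩ := List.mem_map.1 h
    obtain ⟨hsF, hbs⟩ := mem_headP.1 hs
    refine (depSites_ev_smulFun (hG.1 s hsF) (fun δ' => dependsOn_vtStar δ') δ).mono ?_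
    rintro y (hy | hy)
    · have h1 := mem_siteBall.1 hy
      have h3 : s.pos.val ≤ b.val := hbs
      simp only [Set.mem_setOf_eq]; unfold Nat.dist at h1; omega
    · have h1 := mem_siteBall.1 hy
      simp only [Set.mem_setOf_eq]; unfold Nat.dist at h1; omega

/-- The locality radius of the construction: `n₃ + r_n + Rθ + 2 r_n n² + 4`. [cite: DeRoeckHuveneers2015, §5.3 ("depend only on variables indexed by `z` with `|z - a| ≤ C_{n₀}`, for some constant `C_{n₀} < +∞`")] -/
def locRad (n n₃ Rθ : ℕ) : ℕ := n₃ + stageRad n n + Rθ + 2 * stageRad n n * n * n + 4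

/-- The site energies of a right tail depend on that tail. [folklore] -/
theorem depSites_tailEnergy (ε γ : ℝ) (c : ℕ) : DepSites {y : Fin m | c ≤ y.val} (tailEnergy m ε γ c) := by
  intro z z' hz
  simp only [tailEnergy]
  refine Finset.sum_congr rfl fun x _ => ?_
  by_cases hx : c ≤ x.val
  · rw [if_pos hx, if_pos hx]
    unfold siteEnergy sitePotential
    have hb : ∀ y : Fin m, (if y.val = x.val + 1 then (1 - Real.cos (z.1 x - z.1 y)) else 0) =
        (if y.val = x.val + 1 then (1 - Real.cos (z'.1 x - z'.1 y)) else 0) := by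
      intro y
      by_cases hy : y.val = x.val + 1
      · rw [if_pos hy, if_pos hy, (hz x hx).1, (hz y (by simp only [Set.mem_setOf_eq]; omega)).1]
      · rw [if_neg hy, if_neg hy]
    rw [Finset.sum_congr rfl (fun y _ => hb y), (hz x hx).1, (hz x hx).2]
  · rw [if_neg hx, if_neg hx]

/-- The site energies of a left head `H - H^O_{>c}` depend on `{y ≤ c}`. [folklore] -/
theorem depSites_headEnergy (ε γ : ℝ) (c : ℕ) :
    DepSites {y : Fin m | y.val ≤ c} (fun z => hamiltonian m ε γ z - tailEnergy m ε γ c z) := by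
  have e : (fun z => hamiltonian m ε γ z - tailEnergy m ε γ c z) =
      fun z => ∑ x : Fin m, if c ≤ x.val then 0 else siteEnergy m ε γ z x := by
    funext z
    unfold hamiltonian tailEnergy
    rw [← Finset.sum_sub_distrib]
    refine Finset.sum_congr rfl fun x _ => ?_
    split_ifs <;> ring
  rw [e]
  intro z z' hz
  dsimp only
  refine Finset.sum_congr rfl fun x _ => ?_
  by_cases hx : c ≤ x.val
  · rw [if_pos hx, if_pos hx]
  · rw [if_neg hx, if_neg hx]
    unfold siteEnergy sitePotential
    have hx' : x.val ≤ c := by omega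
    have hb : ∀ y : Fin m, (if y.val = x.val + 1 then (1 - Real.cos (z.1 x - z.1 y)) else 0) =
        (if y.val = x.val + 1 then (1 - Real.cos (z'.1 x - z'.1 y)) else 0) := by
      intro y
      by_cases hy : y.val = x.val + 1
      · rw [if_pos hy, if_pos hy, (hz x hx').1, (hz y (by simp only [Set.mem_setOf_eq]; omega)).1]
      · rw [if_neg hy, if_neg hy]
    rw [Finset.sum_congr rfl (fun y _ => hb y), (hz x hx').1, (hz x hx').2]

/-- Thickening a shifted right half-line. [folklore] -/
theorem thick_geShift_subset (R c K : ℕ) : thick R {y : Fin m | c ≤ y.val + K} ⊆ {y : Fin m | c ≤ y.val + (K + R)} := by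
  rintro y ⟨y', hy', hd⟩
  simp only [Set.mem_setOf_eq] at hy' ⊢
  unfold Nat.dist at hd; omega

/-- Thickening a shifted left half-line. [folklore] -/
theorem thick_leShift_subset (R c K : ℕ) : thick R {y : Fin m | y.val ≤ c + K} ⊆ {y : Fin m | y.val ≤ c + (K + R)} := by
  rintro y ⟨y', hy', hd⟩
  simp only [Set.mem_setOf_eq] at hy' ⊢
  unfold Nat.dist at hd; omega

/-- The radii of the scheme increase. [folklore] -/
theorem stageRad_mono (n : ℕ) : ∀ {k k' : ℕ}, k ≤ k' → stageRad n k ≤ stageRad n k' := by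
  intro k k' h
  induction h with
  | refl => exact le_rfl
  | step _ ih => exact ih.trans (Nat.le_add_right _ _)

/-- The generators are good with the top radius `r_n` (for `k ≤ n`; empty beyond). [folklore] -/
theorem gen_good_top (γ : ℝ) (n : ℕ) (δ : ℝ) : ∀ k, 1 ≤ k → (gen m γ n k).Good (stageRad n n) δ := by
  intro k hk
  by_cases hkn : k ≤ n
  · exact (gen_good m γ n δ k hk).mono (stageRad_mono n (by omega))
  · obtain ⟨k', rfl⟩ : ∃ k', k = k' + 1 := ⟨k - 1, by omega⟩
    rw [gen, if_neg (by omega)]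
    exact TrigPoly.good_nil _ _

/-- **Left locality of `U₀ = H^O_{>a} - 𝒯R H̃_{>a}`**: it depends only on the sites
`y ≥ a - (n₃ + r_n + Rθ + 2 r_n n²)`. [cite: DeRoeckHuveneers2015, §5.3 ("we conclude that `R H̃_{>a}`, and so `H_{>a}`, only depends on variables indexed by `z` with `z ≥ a - (n₃ + 4r + n₂ r + r)`")] -/
theorem depSites_U0_left (hδ : 0 < δ) (hδ1 : δ ≤ 1) (ε : ℝ) :
    DepSites {y : Fin m | b.val ≤ y.val + (n₃ + stageRad n n + Θ.Rθ + 2 * stageRad n n * n * n)} (U0 Θ b n₃ γ n ε δ) := by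
  have hT := (depSites_tailEnergy (m := m) ε γ (b.val + 1)).mono
    (show {y : Fin m | b.val + 1 ≤ y.val} ⊆ {y | b.val ≤ y.val + (n₃ + stageRad n n + Θ.Rθ + 2 * stageRad n n * n * n)} from
      fun y hy => by simp only [Set.mem_setOf_eq] at hy ⊢; omega)
  have hH : DepSitesTS {y : Fin m | b.val ≤ y.val + (n₃ + stageRad n n + Θ.Rθ)} (hgtTS Θ b n₃ γ n δ) := by
    intro j
    by_cases hj : j ≤ n
    · rw [val_hgtTS_coeff hδ hδ1 hj]; exact depSites_hgtPoly δ hj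
    · rw [TruncSeries.coeff_eq_zero _ (not_le.1 hj)]; exact DepSites.const _ _
  have hR := DepSitesTS.rOp (n := n) (gen_good_top (m := m) γ n δ) (fun k hk => val_genFun m γ n δ hk) n hH
  have hE := (hR.eval ε).mono (thick_geShift_subset _ _ _)
  unfold U0
  refine hT.sub (hE.mono fun y hy => ?_)
  simp only [Set.mem_setOf_eq] at hy ⊢
  omega

/-- `𝒯R H̃_{>a} + 𝒯R H̃_{≤a} = H` (values). [cite: DeRoeckHuveneers2015, §5.1 ("`H = H_{≤a} + H_{>a} = 𝒯_{n₁}(R H̃_{≤a}) + 𝒯_{n₁}(R H̃_{>a})`")] -/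
theorem eval_rOp_hgt_add_hle (hn : 1 ≤ n) (hδ : 0 < δ) (hδ1 : δ ≤ 1) (ε : ℝ) (z : PhaseSpace m) :
    (TruncSeries.eval ε (TruncSeries.rOp (genFun m γ n δ) n (hgtTS Θ b n₃ γ n δ))).val z +
      (TruncSeries.eval ε (TruncSeries.rOp (genFun m γ n δ) n (hleTS Θ b n₃ γ n δ))).val z = hamiltonian m ε γ z := by
  rw [← val_eval_hamTS hn ε γ z, ← rOp_hgtTS_add (Θ := Θ) (b := b) (n₃ := n₃) hδ hδ1, TruncSeries.eval_add,
    SmoothFun.val_add, Pi.add_apply]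

/-- **`U₀ = -(H^O_{≤a}) + 𝒯R H̃_{≤a}`** (the left-tail form). [cite: DeRoeckHuveneers2015, §5.3 ("`H^O_{>a} - H_{>a} = -(H^O_{≤a} - H_{≤a})`")] -/
theorem U0_eq_neg_head_add (hn : 1 ≤ n) (hδ : 0 < δ) (hδ1 : δ ≤ 1) (ε : ℝ) (z : PhaseSpace m) :
    U0 Θ b n₃ γ n ε δ z = -(hamiltonian m ε γ z - tailEnergy m ε γ (b.val + 1) z) +
      (TruncSeries.eval ε (TruncSeries.rOp (genFun m γ n δ) n (hleTS Θ b n₃ γ n δ))).val z := by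
  have h := eval_rOp_hgt_add_hle (Θ := Θ) (b := b) (n₃ := n₃) (γ := γ) hn hδ hδ1 ε z
  unfold U0
  linarith

/-- **Right locality of `U₀`**: it depends only on the sites `y ≤ a + (n₃ + r_n + Rθ + 2 r_n n² + 1)`.
[cite: DeRoeckHuveneers2015, §5.3] -/
theorem depSites_U0_right (hn : 1 ≤ n) (hδ : 0 < δ) (hδ1 : δ ≤ 1) (ε : ℝ) :
    DepSites {y : Fin m | y.val ≤ b.val + (n₃ + stageRad n n + Θ.Rθ + 2 * stageRad n n * n * n + 1)} (U0 Θ b n₃ γ n ε δ) := by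
  have e : U0 Θ b n₃ γ n ε δ = fun z => -(hamiltonian m ε γ z - tailEnergy m ε γ (b.val + 1) z) +
      (TruncSeries.eval ε (TruncSeries.rOp (genFun m γ n δ) n (hleTS Θ b n₃ γ n δ))).val z :=
    funext fun z => U0_eq_neg_head_add hn hδ hδ1 ε z
  rw [e]
  have hHead := (depSites_headEnergy (m := m) ε γ (b.val + 1)).mono
    (show {y : Fin m | y.val ≤ b.val + 1} ⊆ {y | y.val ≤ b.val + (n₃ + stageRad n n + Θ.Rθ + 2 * stageRad n n * n * n + 1)} from
      fun y hy => by simp only [Set.mem_setOf_eq] at hy ⊢; omega)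
  have hH : DepSitesTS {y : Fin m | y.val ≤ b.val + (n₃ + stageRad n n + Θ.Rθ)} (hleTS Θ b n₃ γ n δ) := by
    intro j
    by_cases hj : j ≤ n
    · rw [val_hleTS_coeff hδ hδ1 hj]; exact depSites_hlePoly δ hj
    · rw [TruncSeries.coeff_eq_zero _ (not_le.1 hj)]; exact DepSites.const _ _
  have hR := DepSitesTS.rOp (n := n) (gen_good_top (m := m) γ n δ) (fun k hk => val_genFun m γ n δ hk) n hH
  have hE := (hR.eval ε).mono (thick_leShift_subset _ _ _)
  refine hHead.neg.add (hE.mono fun y hy => ?_)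
  simp only [Set.mem_setOf_eq] at hy ⊢
  omega

/-- **Gluing two half-line localities** into dependence on an interval around the bond. [folklore] -/
theorem dependsOnlyNear_of_two_sided {f : PhaseSpace m → ℝ} {K : ℕ} (hl : DepSites {y : Fin m | b.val ≤ y.val + K} f)
    (hr : DepSites {y : Fin m | y.val ≤ b.val + K} f) : DependsOnlyNear m b K f := by
  intro z z' hz
  let z'' : PhaseSpace m := (fun y => if y.val ≤ b.val + K then z.1 y else z'.1 y, fun y => if y.val ≤ b.val + K then z.2 y else z'.2 y)
  have h1 : f z = f z'' := hr z z'' fun y hy => by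
    simp only [Set.mem_setOf_eq] at hy
    simp [z'', hy]
  have h2 : f z'' = f z' := hl z'' z' fun y hy => by
    simp only [Set.mem_setOf_eq] at hy
    by_cases hyK : y.val ≤ b.val + K
    · have habs : |(y.val : ℝ) - b.val| ≤ K := by
        rw [abs_le]; constructor
        · have : (b.val : ℝ) ≤ y.val + K := by exact_mod_cast hy
          linarith
        · have : (y.val : ℝ) ≤ b.val + K := by exact_mod_cast hyK
          linarith
      have := hz y habs
      simp [z'', hyK, this.1, this.2]
    · simp [z'', hyK]
  rw [h1, h2]

/-- **Locality of `U₀`** (field `local_U`): `U₀` depends only on the sites within `locRad n n₃ Rθ` of the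
bond. [cite: DeRoeckHuveneers2015, §2.3 Thm 1 ("depend only on variables labeled by `z ∈ ℤ_N` with `|z - a| ≤ C_n`") and §5.3] -/
theorem dependsOnlyNear_U0 (hn : 1 ≤ n) (hδ : 0 < δ) (hδ1 : δ ≤ 1) (ε : ℝ) :
    DependsOnlyNear m b (locRad n n₃ Θ.Rθ) (U0 Θ b n₃ γ n ε δ) := by
  refine dependsOnlyNear_of_two_sided ((depSites_U0_left hδ hδ1 ε).mono fun y hy => ?_)
    ((depSites_U0_right hn hδ hδ1 ε).mono fun y hy => ?_)
  · simp only [Set.mem_setOf_eq, locRad] at hy ⊢; omega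
  · simp only [Set.mem_setOf_eq, locRad] at hy ⊢; omega

/-! ### Locality of `G₀` -/

/-- `H = D + εV` symbolically, as one good polynomial of radius `1`. [cite: DeRoeckHuveneers2015, §3.1] -/
theorem hamiltonian_eq_ev (ε γ δ : ℝ) :
    hamiltonian m ε γ = TrigPoly.ev (kinPoly m ++ TrigPoly.constSMul ε (potPoly m γ)) δ := by
  funext z
  rw [TrigPoly.ev_append, TrigPoly.ev_constSMul, ev_kinPoly, ev_potPoly, hamiltonian_eq_kinetic_add]

/-- That polynomial is good with radius `1`. [folklore] -/
theorem hamPoly_good (ε γ δ : ℝ) : (kinPoly m ++ TrigPoly.constSMul ε (potPoly m γ)).Good 1 δ := by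
  have h0 := hamSeries_good m 1 γ δ 0 (Nat.zero_le 1)
  have h1 := hamSeries_good m 1 γ δ 1 le_rfl
  simp only [hamSeries, if_true, one_ne_zero, if_false] at h0 h1
  exact h0.append (h1.constSMul ε)

/-- The bond current depends on the two sites of the bond. [folklore] -/
theorem depSites_bondCurrent (b : Fin m) : DepSites {y : Fin m | y.val = b.val ∨ y.val = b.val + 1} (bondCurrent m b) := by
  intro z z' hz
  unfold bondCurrent
  refine Finset.sum_congr rfl fun y _ => ?_
  by_cases hy : y.val = b.val + 1
  · rw [if_pos hy, if_pos hy, (hz y (Or.inr hy)).2, (hz y (Or.inr hy)).1, (hz b (Or.inl rfl)).1]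
  · rw [if_neg hy, if_neg hy]

/-- `L_H f` depends on the `2`-thickening of the sites of `f`. [folklore] -/
theorem depSites_liouville {S : Set (Fin m)} {f : PhaseSpace m → ℝ} (hf : DepSites S f) (ε γ : ℝ) :
    DepSites (thick 2 S) (liouville m ε γ f) := by
  have e : liouville m ε γ f = _root_.Literature.MathematicalPhysics.KineticTheory.HeatConduction.poisson
      (TrigPoly.ev (kinPoly m ++ TrigPoly.constSMul ε (potPoly m γ)) 1) f := by
    funext z
    show _root_.Literature.MathematicalPhysics.KineticTheory.HeatConduction.poisson (hamiltonian m ε γ) f z = _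
    rw [hamiltonian_eq_ev ε γ 1]
  rw [e]
  exact DepSites.poisson_ev_local (hamPoly_good ε γ 1) hf

/-- **Locality of `G₀`** (field `local_G`): `G₀ = ε^{-(n₀+1)}(εJ - L_H U₀)` depends only on the sites within
`locRad n n₃ Rθ` of the bond. [cite: DeRoeckHuveneers2015, §2.3 Thm 1 ("depend only on variables labeled by `z ∈ ℤ_N` with `|z - a| ≤ C_n`") and §5.3] -/
theorem dependsOnlyNear_G0 (hn : 1 ≤ n) (n₀ : ℕ) (hδ : 0 < δ) (hδ1 : δ ≤ 1) (ε : ℝ) :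
    DependsOnlyNear m b (locRad n n₃ Θ.Rθ) (G0 Θ b n₃ γ n₀ n ε δ) := by
  by_cases hε : ε = 0
  · intro z z' _
    simp [G0, hε]
  · have e : G0 Θ b n₃ γ n₀ n ε δ = fun z => (ε ^ (n₀ + 1))⁻¹ * (ε * bondCurrent m b z - liouville m ε γ (U0 Θ b n₃ γ n ε δ) z) := by
      funext z
      have h := current_identity (Θ := Θ) (b := b) (n₃ := n₃) hn n₀ hε γ δ z
      have hp : ε ^ (n₀ + 1) ≠ 0 := pow_ne_zero _ hε
      field_simp
      linarith
    rw [e]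
    have hJl : DepSites {y : Fin m | b.val ≤ y.val + (n₃ + stageRad n n + Θ.Rθ + 2 * stageRad n n * n * n)} (bondCurrent m b) :=
      (depSites_bondCurrent b).mono fun y hy => by
        simp only [Set.mem_setOf_eq] at hy ⊢; rcases hy with hy | hy <;> omega
    have hJr : DepSites {y : Fin m | y.val ≤ b.val + (n₃ + stageRad n n + Θ.Rθ + 2 * stageRad n n * n * n + 1)} (bondCurrent m b) :=
      (depSites_bondCurrent b).mono fun y hy => by
        simp only [Set.mem_setOf_eq] at hy ⊢; rcases hy with hy | hy <;> omega
    have hl := ((hJl.const_mul ε).mono (subset_thick 2 _)).sub (depSites_liouville (depSites_U0_left (Θ := Θ) (γ := γ) hδ hδ1 ε) ε γ)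
    have hr' := ((hJr.const_mul ε).mono (subset_thick 2 _)).sub (depSites_liouville (depSites_U0_right (Θ := Θ) (γ := γ) hn hδ hδ1 ε) ε γ)
    refine dependsOnlyNear_of_two_sided ((hl.const_mul _).mono ?_) ((hr'.const_mul _).mono ?_)
    · refine (thick_geShift_subset 2 _ _).trans fun y hy => ?_
      simp only [Set.mem_setOf_eq, locRad] at hy ⊢; omega
    · refine (thick_leShift_subset 2 _ _).trans fun y hy => ?_
      simp only [Set.mem_setOf_eq, locRad] at hy ⊢; omega

end Loc

end Literature.Barriers.AtomisticToContinuum.HeatConduction.RotorChain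

end
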